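import Mathlib
import HarnessLib
import Literature.Probability.MarkovChains.MetropolisHastings
import Summits.Ventures.LatticeQCDFlow.Exactness.CensoredChain
import Summits.Ventures.LatticeQCDFlow.Exactness.NCMCExpandedEnsemble

/-!
# Entry-state tilt: the state at ENTRY into a level is the level's law tilted by the exit probability

HONEST FRAMING: exact (Metropolis-corrected) sampling algorithms for lattice gauge theory;
figures of merit are autocorrelation/cost numbers at stated couplings and volumes; no
continuum-physics claim.

Venture `LatticeQCDFlow` (cell pub-lqcd), topic `Exactness`; FANOUT row 13 (`eng-snf`, GEN-9).
NEW WORK of the cell (elementary finite sums), not a published result; nothing is cited as a fact.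
The classical names (the entrance / exit laws of a stationary chain on a set, Kac's cycle formula,
the "chain watched on `A`") appear in docstrings only (Kemeny–Snell, *Finite Markov Chains* (1960)
ch. III, VI; Aldous–Fill, *Reversible Markov Chains* ch. 2 §2.1, ch. 3 §5).

WHY (engine dictionary, `latflow-snf` ≥ 0.1.9 `snf.ncmc`, the `ncmc-metropolis` sampler on
`Bool × X`; docstring note "ENTRY-STATE TILT" of `snf/ncmc.py` 0.1.10.dev0): the target states
observed RIGHT AFTER an accepted forward switch are NOT target-distributed — on 2-d U(1) `16²`
`β 7` the note measures `⟨Q²⟩ = 1.088 ± 0.017` over entry states against the exact `1.006`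
(`+4.8 σ`), while the average over ALL target-level samples gives `1.021 ± 0.018`.  THIS file is
the exact statement behind both numbers:

* in stationarity and detailed balance the one-step ENTRANCE FLOW into a state `z ∈ A` from
  outside `A` equals `π z` times the one-step EXIT PROBABILITY from `z`
  (`entranceFlow_eq_mul_exitProb`) — entering and leaving are time reverses of each other — so the
  law of the state at entry is `π|_A` TILTED BY THE EXIT PROBABILITY (`entryLaw_eq_tilt`), its
  mean of an observable `f` is `E_{π|A}[f r] / E_{π|A}[r]` (`entryMean_eq`) and its bias is the
  covariance `Cov_{π|A}(f, r) / E_{π|A}[r]` (`entryMean_sub_condMean`): states that leave sooner are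
  entered more often; no tilt iff the exit probability is constant on the level
  (`entryLaw_eq_cond_of_exitProb_const`);
* the TIME AVERAGE over all samples taken while in `A` is nevertheless exact: the entrance flow
  propagated by a fundamental kernel `N` of the block `A` (expected numbers of visits before leaving)
  is `π|_A` (`sojourn_compensation` — `CensoredChain.pi_compl_eq_entrance` read on the other
  block; stationarity only), hence `Σ_z e(z)·(N f)(z) = Σ_{w ∈ A} π w f w` (`entrance_sojourn_sum`)
  and the sojourn-length-weighted ratio of entry-started sums is the conditional mean
  (`entrance_sojourn_ratio`): shorter stays compensate the tilt exactly — which is why the engine's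
  `target_means` / `censored_target_chain` average every target-level sample and never entry states
  alone;
* for `snf.ncmc` (`Exactness/NCMCExpandedEnsemble.lean`: weight `ncmcWeight c S`, switch kernel
  `ncmcKernel c S P`, iteration `compKernel (levelKernel T₀ T₁) (ncmcKernel c S P)`): the entrance
  flow into the target state `y` — for the bare switch AND for the engine's iteration "relax at the
  level, then switch" (`ncmcIteration_entranceFlow`) — is `e^{c} e^{-S n y} · r y`, `r y = Σ_x
  revSwitch c S P y x` the probability that the reverse switch attempted from `y` is accepted
  (`ncmc_entranceFlow_target`); so the entry-state mean of `f` is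
  `Σ_y gibbsLaw (S n) y · r y · f y / Σ_y gibbsLaw (S n) y · r y` for EVERY `c` (`ncmc_entryMean`):
  the reverse acceptance rises with `|Q|` on the note's lattice (0.38 → 0.48 for `|Q|` 0 → 3), so
  high-`|Q|` states are over-represented at entry, exactly by the factor `r / E[r]`.

Setting: finite `X`, a weight `π : X → ℝ` and a kernel `K : X → X → ℝ` (`DetailedBalance`,
`IsStationary` of `Literature/Probability/MarkovChains/MetropolisHastings.lean`), a set
`A : Finset X`; `r = exitProb K A`.
-/

namespace Summit.Ventures.LatticeQCDFlow.Exactness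

open Finset
open Literature.Probability.MarkovChains

variable {X : Type*} [Fintype X] [DecidableEq X]

/-! ## Entrance flow, exit probability, entry law -/

/-- Stationary one-step ENTRANCE FLOW into `z` from outside `A`: `Σ_{y ∉ A} π y · K y z`. -/
noncomputable def entranceFlow (π : X → ℝ) (K : X → X → ℝ) (A : Finset X) (z : X) : ℝ :=
  ∑ y ∈ Aᶜ, π y * K y z

/-- One-step EXIT PROBABILITY from `z` to outside `A`: `r z = Σ_{y ∉ A} K z y`. -/
noncomputable def exitProb (K : X → X → ℝ) (A : Finset X) (z : X) : ℝ :=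
  ∑ y ∈ Aᶜ, K z y

/-- The stationary law of the state AT ENTRY into `A` (entrance flow normalised over `A`). -/
noncomputable def entryLaw (π : X → ℝ) (K : X → X → ℝ) (A : Finset X) (z : X) : ℝ :=
  entranceFlow π K A z / ∑ w ∈ A, entranceFlow π K A w

/-- **Entrance flow = invariant weight × exit probability** (detailed balance): entering `A` at
`z` and leaving `A` from `z` are time reverses of each other, `Σ_{y ∉ A} π y K y z = π z · r z`. -/
theorem entranceFlow_eq_mul_exitProb {π : X → ℝ} {K : X → X → ℝ} (hdb : DetailedBalance π K)
    (A : Finset X) (z : X) : entranceFlow π K A z = π z * exitProb K A z := by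
  unfold entranceFlow exitProb
  rw [mul_sum]
  exact sum_congr rfl fun y _ => hdb y z

/-- With stationarity alone only the TOTALS balance across the cut: the stationary flow into `A`
equals the stationary flow out of `A`, `Σ_{z ∈ A} e z = Σ_{z ∈ A} π z · r z` (the pointwise
identity needs reversibility: for the cyclic kernel on three states with the uniform law and
`A = {0, 1}`, state `0` is entered with flow `1/3` and never left to `Aᶜ`). -/
theorem sum_entranceFlow_eq_sum_exitFlow {π : X → ℝ} {K : X → X → ℝ} (hst : IsStationary π K)
    (hK : ∀ x, ∑ y, K x y = 1) (A : Finset X) :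
    ∑ z ∈ A, entranceFlow π K A z = ∑ z ∈ A, π z * exitProb K A z := by
  -- flow in = π(A) − internal flow = flow out
  have hin : ∀ z, entranceFlow π K A z = π z - ∑ x ∈ A, π x * K x z := fun z => by
    have := sum_A_add_sum_compl_stationary hst A z
    unfold entranceFlow
    linarith
  have hout : ∀ x, π x * exitProb K A x = π x - ∑ z ∈ A, π x * K x z := fun x => by
    unfold exitProb
    have hsplit := sum_add_sum_compl A (fun y => K x y)
    rw [hK x] at hsplit
    rw [← mul_sum, show ∑ y ∈ Aᶜ, K x y = 1 - ∑ z ∈ A, K x z by linarith]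
    ring
  simp_rw [hin, hout, sum_sub_distrib]
  rw [sum_comm]

/-- **The entry law is `π|_A` tilted by the exit probability**:
`entryLaw z = π z r z / Σ_{w ∈ A} π w r w`. -/
theorem entryLaw_eq_tilt {π : X → ℝ} {K : X → X → ℝ} (hdb : DetailedBalance π K) (A : Finset X)
    (z : X) : entryLaw π K A z = π z * exitProb K A z / ∑ w ∈ A, π w * exitProb K A w := by
  unfold entryLaw
  simp_rw [entranceFlow_eq_mul_exitProb hdb]

/-- **Entry-state mean of an observable** = the exit-tilted conditional mean:
`Σ_{z ∈ A} entryLaw z · f z = Σ_{z ∈ A} π z r z f z / Σ_{z ∈ A} π z r z`. -/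
theorem entryMean_eq {π : X → ℝ} {K : X → X → ℝ} (hdb : DetailedBalance π K) (A : Finset X)
    (f : X → ℝ) :
    ∑ z ∈ A, entryLaw π K A z * f z =
      (∑ z ∈ A, π z * exitProb K A z * f z) / ∑ z ∈ A, π z * exitProb K A z := by
  simp_rw [entryLaw_eq_tilt hdb, div_mul_eq_mul_div, ← sum_div]

/-- **The bias of entry-state averaging is a covariance**: with `E f = Σ_A π f / Σ_A π` the
conditional mean on `A`, `Σ_A entryLaw · f − E f = (E (f·r) − E f · E r) / E r`
(`= Cov_{π|A}(f, r) / E_{π|A} r`): states that leave sooner are entered more often. -/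
theorem entryMean_sub_condMean {π : X → ℝ} {K : X → X → ℝ} (hdb : DetailedBalance π K)
    (A : Finset X) (f : X → ℝ) (hπ : ∑ z ∈ A, π z ≠ 0) (hr : ∑ z ∈ A, π z * exitProb K A z ≠ 0) :
    ∑ z ∈ A, entryLaw π K A z * f z - (∑ z ∈ A, π z * f z) / ∑ z ∈ A, π z =
      ((∑ z ∈ A, π z * (f z * exitProb K A z)) / (∑ z ∈ A, π z) -
          (∑ z ∈ A, π z * f z) / (∑ z ∈ A, π z) *
            ((∑ z ∈ A, π z * exitProb K A z) / ∑ z ∈ A, π z)) /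
        ((∑ z ∈ A, π z * exitProb K A z) / ∑ z ∈ A, π z) := by
  rw [entryMean_eq hdb]
  have h3 : ∑ z ∈ A, π z * exitProb K A z * f z = ∑ z ∈ A, π z * (f z * exitProb K A z) :=
    sum_congr rfl fun z _ => by ring
  rw [h3]
  field_simp

/-- **No tilt iff nothing to tilt by**: if the exit probability is a non-zero constant on `A`, the
entry law is the conditional law `π z / Σ_A π`. -/
theorem entryLaw_eq_cond_of_exitProb_const {π : X → ℝ} {K : X → X → ℝ} (hdb : DetailedBalance π K)
    {A : Finset X} {ρ : ℝ} (hρ : ρ ≠ 0) (hr : ∀ z ∈ A, exitProb K A z = ρ) {z : X} (hz : z ∈ A) :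
    entryLaw π K A z = π z / ∑ w ∈ A, π w := by
  rw [entryLaw_eq_tilt hdb, hr z hz]
  have hden : ∑ w ∈ A, π w * exitProb K A w = (∑ w ∈ A, π w) * ρ := by
    rw [sum_mul]
    exact sum_congr rfl fun w hw => by rw [hr w hw]
  rw [hden, mul_div_mul_right _ _ hρ]

/-! ## Sojourn compensation: the time average over the level is exact -/

/-- **Sojourn compensation (Kac's cycle formula, algebraic form).**  Let `N` be a fundamental
kernel of the block `A` (first resolvent identity `N = 1 + K_AA N` on `A × A`; satisfied by the
expected numbers of visits `Σ_k K_AA^k` before leaving `A`).  Then the entrance flow propagated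
through the sojourn is the invariant weight: `π w = Σ_{z ∈ A} e z · N z w` for `w ∈ A` —
stationarity only (`CensoredChain.pi_compl_eq_entrance` read on the complementary block). -/
theorem sojourn_compensation {π : X → ℝ} {K N : X → X → ℝ} (hst : IsStationary π K)
    {A : Finset X}
    (hN : ∀ y ∈ A, ∀ w ∈ A, N y w = (if y = w then 1 else 0) + ∑ v ∈ A, K y v * N v w)
    {w : X} (hw : w ∈ A) :
    π w = ∑ z ∈ A, entranceFlow π K A z * N z w := by
  have hN' : ∀ y ∈ Aᶜᶜ, ∀ w ∈ Aᶜᶜ, N y w = (if y = w then 1 else 0) + ∑ v ∈ Aᶜᶜ, K y v * N v w := by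
    simpa only [compl_compl] using hN
  have hw' : w ∈ Aᶜᶜ := by simpa only [compl_compl] using hw
  have h := pi_compl_eq_entrance hst (A := Aᶜ) hN' hw'
  simpa only [compl_compl, entranceFlow] using h

/-- **Entry-started sojourn sums are exact in total**: `Σ_{z ∈ A} e z · Σ_{w ∈ A} N z w f w =
Σ_{w ∈ A} π w f w` — the expected sum of `f` over a stay in `A`, weighted by how often each entry
state is used, is the invariant-weighted sum (so over a long run the plain average of `f` over ALL
samples taken in `A` estimates the conditional mean, tilt notwithstanding). -/
theorem entrance_sojourn_sum {π : X → ℝ} {K N : X → X → ℝ} (hst : IsStationary π K)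
    {A : Finset X}
    (hN : ∀ y ∈ A, ∀ w ∈ A, N y w = (if y = w then 1 else 0) + ∑ v ∈ A, K y v * N v w)
    (f : X → ℝ) :
    ∑ z ∈ A, entranceFlow π K A z * ∑ w ∈ A, N z w * f w = ∑ w ∈ A, π w * f w := by
  calc ∑ z ∈ A, entranceFlow π K A z * ∑ w ∈ A, N z w * f w
      = ∑ w ∈ A, (∑ z ∈ A, entranceFlow π K A z * N z w) * f w := by
        simp_rw [mul_sum, sum_mul]
        rw [sum_comm]
        exact sum_congr rfl fun w _ => sum_congr rfl fun z _ => by ring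
    _ = ∑ w ∈ A, π w * f w :=
        sum_congr rfl fun w hw => by rw [← sojourn_compensation hst hN hw]

/-- Kac: the entrance flow times the expected sojourn length sums to the invariant mass of `A`,
`Σ_{z ∈ A} e z · Σ_{w ∈ A} N z w = Σ_{w ∈ A} π w` (mean stay = `π(A)` / flow). -/
theorem entrance_sojourn_mass {π : X → ℝ} {K N : X → X → ℝ} (hst : IsStationary π K)
    {A : Finset X}
    (hN : ∀ y ∈ A, ∀ w ∈ A, N y w = (if y = w then 1 else 0) + ∑ v ∈ A, K y v * N v w) :
    ∑ z ∈ A, entranceFlow π K A z * ∑ w ∈ A, N z w = ∑ w ∈ A, π w := by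
  have h := entrance_sojourn_sum hst hN (fun _ => (1 : ℝ))
  simpa only [mul_one] using h

/-- **The sojourn-weighted ratio of entry-started sums is the conditional mean**:
`(Σ_z entryLaw z · (N f) z) / (Σ_z entryLaw z · (N 1) z) = Σ_A π f / Σ_A π` — the tilt of the
entry law and the state-dependence of the stay cancel exactly (stationarity only; the
normalisation of `entryLaw` drops out of the ratio). -/
theorem entrance_sojourn_ratio {π : X → ℝ} {K N : X → X → ℝ} (hst : IsStationary π K)
    {A : Finset X}
    (hN : ∀ y ∈ A, ∀ w ∈ A, N y w = (if y = w then 1 else 0) + ∑ v ∈ A, K y v * N v w)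
    (he : ∑ w ∈ A, entranceFlow π K A w ≠ 0) (f : X → ℝ) :
    (∑ z ∈ A, entryLaw π K A z * ∑ w ∈ A, N z w * f w) /
        (∑ z ∈ A, entryLaw π K A z * ∑ w ∈ A, N z w) =
      (∑ w ∈ A, π w * f w) / ∑ w ∈ A, π w := by
  unfold entryLaw
  simp_rw [div_mul_eq_mul_div, ← sum_div]
  rw [entrance_sojourn_sum hst hN f, entrance_sojourn_mass hst hN, div_div_div_cancel_right₀ he]

/-! ## The `ncmc-metropolis` sampler: entry into the target level -/

section NCMC

variable {n : ℕ}

/-- Off the diagonal the switch kernel is the accepted-move weight: prior `x` → target `y` is the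
accepted forward switch `fwdSwitch c S P x y`. -/
theorem ncmcKernel_false_true (c : ℝ) (S : Fin (n + 1) → X → ℝ) (P : Fin n → X → X → ℝ)
    (x y : X) : ncmcKernel c S P (false, x) (true, y) = fwdSwitch c S P x y := by
  unfold ncmcKernel
  rw [if_neg (by simp), add_zero]
  rfl

/-- … and target `y` → prior `x` is the accepted reverse switch `revSwitch c S P y x`. -/
theorem ncmcKernel_true_false (c : ℝ) (S : Fin (n + 1) → X → ℝ) (P : Fin n → X → X → ℝ)
    (y x : X) : ncmcKernel c S P (true, y) (false, x) = revSwitch c S P y x := by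
  unfold ncmcKernel
  rw [if_neg (by simp), add_zero]
  rfl

/-- **Entry-state tilt of the NCMC sampler.**  In stationarity the entrance flow into the target
state `y` (prior level carrying its invariant weight `e^{-S 0}`, one Metropolized forward switch)
is the target weight times the REVERSE-SWITCH ACCEPTANCE PROBABILITY from `y`:
`Σ_x e^{-S 0 x} F_c(x → y) = e^{c} e^{-S n y} · Σ_x R_c(y → x)` — for every `c`. -/
theorem ncmc_entranceFlow_target [Nonempty X] (c : ℝ) (S : Fin (n + 1) → X → ℝ)
    (P : Fin n → X → X → ℝ) (y : X) :
    ∑ x, ncmcWeight c S (false, x) * fwdSwitch c S P x y =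
      ncmcWeight c S (true, y) * ∑ x, revSwitch c S P y x := by
  rw [mul_sum]
  refine sum_congr rfl fun x _ => ?_
  simp only [ncmcWeight]
  exact fwdSwitch_balance c S P x y

/-- The same flow for the engine's ITERATION "relax at the current level, then switch"
(`compKernel (levelKernel T₀ T₁) (ncmcKernel c S P)`, `T₀` stationary for `e^{-S 0}`): level-wise
relaxation neither changes the level nor the prior level's weight, so the entrance flow into the
target state `y` is again `e^{c} e^{-S n y} · Σ_x R_c(y → x)`. -/
theorem ncmcIteration_entranceFlow [Nonempty X] (c : ℝ) (S : Fin (n + 1) → X → ℝ)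
    (P : Fin n → X → X → ℝ) (T₀ T₁ : X → X → ℝ)
    (h₀ : IsStationary (fun x => Real.exp (-S 0 x)) T₀) (y : X) :
    ∑ x, ncmcWeight c S (false, x) *
        compKernel (levelKernel T₀ T₁) (ncmcKernel c S P) (false, x) (true, y) =
      ncmcWeight c S (true, y) * ∑ x, revSwitch c S P y x := by
  -- the composite step from (false, x) to (true, y) goes through a prior state (false, x')
  have hstep : ∀ x, compKernel (levelKernel T₀ T₁) (ncmcKernel c S P) (false, x) (true, y) =
      ∑ x', T₀ x x' * fwdSwitch c S P x' y := fun x => by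
    unfold compKernel
    rw [Fintype.sum_prod_type, Fintype.sum_bool]
    simp only [levelKernel, zero_mul, sum_const_zero, zero_add, ncmcKernel_false_true]
  simp_rw [hstep]
  calc ∑ x, ncmcWeight c S (false, x) * ∑ x', T₀ x x' * fwdSwitch c S P x' y
      = ∑ x', (∑ x, Real.exp (-S 0 x) * T₀ x x') * fwdSwitch c S P x' y := by
        simp_rw [mul_sum, sum_mul]
        rw [sum_comm]
        exact sum_congr rfl fun x' _ => sum_congr rfl fun x _ => by
          simp only [ncmcWeight]; ring
    _ = ∑ x', ncmcWeight c S (false, x') * fwdSwitch c S P x' y :=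
        sum_congr rfl fun x' _ => by rw [h₀ x']; rfl
    _ = ncmcWeight c S (true, y) * ∑ x, revSwitch c S P y x := ncmc_entranceFlow_target c S P y

/-- **What averaging over entry states measures.**  The stationary mean of an observable `f` over
the target states RIGHT AFTER an accepted forward switch (prior level in equilibrium
`gibbsLaw (S 0)`) is the target Gibbs mean TILTED BY THE REVERSE ACCEPTANCE `r y = Σ_x R_c(y → x)`:
`Σ_y (Σ_x gibbsLaw (S 0) x F_c(x → y)) f y / Σ_y Σ_x gibbsLaw (S 0) x F_c(x → y)
 = Σ_y gibbsLaw (S n) y · r y · f y / Σ_y gibbsLaw (S n) y · r y` — for every `c` (at `c = ΔF` the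
denominator on the right is row 8's `ncmcRevAccRate = ncmcAccRate`,
`NCMCExpandedEnsembleKernel.gibbs_revSwitch_eq_ncmcRevAccRate`).  Equal to the target mean iff `f`
and `r` are uncorrelated under `gibbsLaw (S n)`; the time average over all target-level samples is
exact regardless (`entrance_sojourn_ratio`, `CensoredChain.censoredKernel_stationaryOn`). -/
theorem ncmc_entryMean [Nonempty X] (c : ℝ) (S : Fin (n + 1) → X → ℝ) (P : Fin n → X → X → ℝ)
    (f : X → ℝ) :
    (∑ y, (∑ x, gibbsLaw (S 0) x * fwdSwitch c S P x y) * f y) /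
        (∑ y, ∑ x, gibbsLaw (S 0) x * fwdSwitch c S P x y) =
      (∑ y, gibbsLaw (S (Fin.last n)) y * (∑ x, revSwitch c S P y x) * f y) /
        (∑ y, gibbsLaw (S (Fin.last n)) y * ∑ x, revSwitch c S P y x) := by
  have hZ0 : 0 < partitionFn (S 0) := Theory2.partitionFn_pos (S 0)
  have hZn : 0 < partitionFn (S (Fin.last n)) := Theory2.partitionFn_pos (S (Fin.last n))
  -- un-normalised flows: `Σ_x e^{-S 0 x} F(x → y) = e^{c} e^{-S n y} r y`
  have hflow : ∀ y, ∑ x, gibbsLaw (S 0) x * fwdSwitch c S P x y =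
      Real.exp c / partitionFn (S 0) * (Real.exp (-S (Fin.last n) y) * ∑ x, revSwitch c S P y x) :=
    fun y => by
    have h := ncmc_entranceFlow_target c S P y
    simp only [ncmcWeight] at h
    calc ∑ x, gibbsLaw (S 0) x * fwdSwitch c S P x y
        = (∑ x, Real.exp (-S 0 x) * fwdSwitch c S P x y) / partitionFn (S 0) := by
          rw [sum_div]
          exact sum_congr rfl fun x _ => by unfold gibbsLaw; ring
      _ = Real.exp c / partitionFn (S 0) *
            (Real.exp (-S (Fin.last n) y) * ∑ x, revSwitch c S P y x) := by
          rw [h]; ring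
  have hg : ∀ y, gibbsLaw (S (Fin.last n)) y * (∑ x, revSwitch c S P y x) =
      (1 / partitionFn (S (Fin.last n))) *
        (Real.exp (-S (Fin.last n) y) * ∑ x, revSwitch c S P y x) := fun y => by
    unfold gibbsLaw; ring
  simp_rw [hflow, hg, mul_assoc, ← mul_sum]
  have hc : Real.exp c / partitionFn (S 0) ≠ 0 := (div_pos (Real.exp_pos c) hZ0).ne'
  have hn : (1 / partitionFn (S (Fin.last n))) ≠ 0 := (div_pos one_pos hZn).ne'
  rw [mul_div_mul_left _ _ hc, mul_div_mul_left _ _ hn]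

end NCMC

end Summit.Ventures.LatticeQCDFlow.Exactness
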